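import Mathlib
import Summits.ValiantsHypothesis.ValiantsHypothesis.Statement
import Summits.ValiantsHypothesis.ValiantsHypothesis.Cruxes.OrbitDimensionBound.Lines.PiecewiseLadder

/-!
# `piecewise_covering` — ON-PATH CHECK `S → Rung` (forward rung g4, crux `FreeSubtorus.OrbitDimensionBound`)

The rung declaration handed to the kernel is the eventual shadow `Piecewise.PieceShadow` (the numeric rung
`PiecewiseCovering` implies it: `pieceShadow_of_piecewiseCovering`).  `S → PieceShadow` is PROVED in the ladder
(`pieceShadow_of_summit`: a piecewise-equivariant decomposition with p-bounded `k · m · 2^r` would give `per_n`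
p-bounded straight-line complexity `≤ k (8(m+1)^7 + m²(2n²+1)) + k`, contradicting `VP ≠ VNP` through
`isPComputable_perPoly_complex_iff`), and registered `@[aesop safe apply]`, so the kernel's on-path probe
`intro h; aesop` closes — recorded `s_implies_c: closed (intro h; aesop)`, `on_path: true` in
`tribunal_kernel.json` of the filing seat.
-/

set_option linter.dupNamespace false

namespace Summit.ValiantsHypothesis.ValiantsHypothesis.Cruxes.OrbitDimensionBound.Piecewise.OnPath

open Summit.ValiantsHypothesis.ValiantsHypothesis.Cruxes.OrbitDimensionBound.Piecewise

/-- `S → Rung` by name. -/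
theorem rung_of_summit (hS : _root_.ValiantsHypothesis) : PieceShadow := pieceShadow_of_summit hS

/-- The kernel's probe shape. -/
example : _root_.ValiantsHypothesis → PieceShadow := by
  intro h
  aesop

/-- And the numeric rung feeds the shadow. -/
example (h : PiecewiseCovering) : PieceShadow := pieceShadow_of_piecewiseCovering h

end Summit.ValiantsHypothesis.ValiantsHypothesis.Cruxes.OrbitDimensionBound.Piecewise.OnPath
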